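import Summits.MatrixMultiplication.MatrixMultiplication.Theorems.ObstructionDescentInformationAxis
import Summits.MatrixMultiplication.MatrixMultiplication.Theorems.ObstructionCalculusPointwiseSaturation

set_option linter.dupNamespace false
set_option autoImplicit false

/-!
# The information axis of `ObstructionDescent` lives on the CORE WINDOW (decomp-mm · lens 3 · gen 26, second kernel)

Route `route-MatrixMultiplication-ObstructionDescent` (`ω(ℂ) = 2`), items `P_O = NoOccurrenceObstruction` (crux 29040),
`P_M = NoMultiplicityObstruction` (support 29041), `L = OccurrenceLifts := P_O → P_M` (crux 29042).  Write
`ℓ_s(Λ) = #{a : λ^{(s)}_a ≠ 0}` for the number of parts of the type `Λ` in slot `s`.  The CORE WINDOW of a cell `(τ, n, m)`,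
`2 < τ`, `n² ≤ m`, `n^τ ≤ m`, is the set of types/degrees `(Λ, d)` with

  `τ < 4`,  `d > m`,  `ℓ_s(Λ) ≤ n²` for all three slots,  `ℓ_s(Λ)·ℓ_{s'}(Λ) > m` for all three slot pairs.

OFF the window every instance of `P_O` and of `P_M` is a THEOREM of the landed obstruction calculus: many parts in a slot ⟹
pad inheritance (`hwvSpace_le_orbitVanishing_padMM_of_lt_card`, `coMult_le_coMult_padMM_of_lt_card`); `d ≤ m` or a small slot
pair or `τ ≥ 4` (whence `ℓ_0 ℓ_1 ≤ n⁴ ≤ m`) ⟹ saturation (`hwvSpace_eq_bot_of_…`, pointwise `coMult_unitTensor_eq_zero_of_…`).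
Hence the KERNEL LOCALISATIONS

* `noOccurrenceObstruction_iff_core : P_O ⟺ P_O|core`, `noMultiplicityObstruction_iff_core : P_M ⟺ P_M|core`,
  `occurrenceLifts_iff_core : L ⟺ (P_O → P_M|core)` — the two information-axis leaves and their support are EXACTLY their
  restrictions to the core window (same binders as the items, four extra hypotheses);
* the crux line of `P_O` by name: `noOccurrenceObstruction_of_core : UnitSaturationCore ⟹ P_O`, where `UnitSaturationCore`
  (the one open stub of the line `birth` of crux 29040, gen 7) is the SATURATION form on the window — `HWV_{Λ,d} ≤ I(σ_m) ⟹
  HWV_{Λ,d} = ⊥` — and `unitSaturation_of_core`, `noOccurrenceObstruction_of_unitSaturation` are the gen-6/7 compositions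
  (`PadInheritance` discharged by the landed theorem); `coreO_of_coreSat` records that the saturation form implies the window
  form of `P_O` (so the stub is sufficient, and `P_O|core` is the necessary-and-sufficient residue).

Reading for the dossier (no item changes): every counterexample to `P_O`, `P_M` or `L` — i.e. every occurrence or multiplicity
obstruction proof of `ω > 2` in this frame — is a type in the core window: super-linear degree `d > m ≥ n^τ`, at most `n²` parts
per slot, more than `m` part-pairs per slot pair, `τ < 4`; in particular it lies above the cactus/determinantal range.
No definition is introduced (`ℓ_s` is inlined); sorry-free; axioms `propext`, `Classical.choice`, `Quot.sound`.  Nothing here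
proves `ω = 2`.  Source: gen-7 kernel Part 3 (evidence #5 on item 29040) re-based on the tree, plus the new localisations.
[cite: BurgisserIkenmeyer2011, §3.1, §7, Problem 8.3; Blaser2013, §5]
-/

noncomputable section

open scoped BigOperators

namespace Summit.MatrixMultiplication.MatrixMultiplication.Theorems.ObstructionDescentCoreWindow

open Literature.Computability.AlgebraicComplexity (tensorRank matMulTensor unitTensor)
open Summit.MatrixMultiplication.MatrixMultiplication.Theorems.ObstructionCalculus
open Summit.MatrixMultiplication.MatrixMultiplication.Theses.ObstructionDescent
open Summit.MatrixMultiplication.MatrixMultiplication.Theorems.ObstructionDescentInformationAxis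

/-! ### §0 · The scale inequality of the regime `τ ≥ 4` -/

/-- Case split used off the window (occurrence side): either the type saturates or the instance is supplied. [bookkeeping] -/
theorem hwvSpace_le_of_cases {m : ℕ} {Λ : Fin 3 → Fin m → ℕ} {d : ℕ} {t : Tensor ℂ m} (P : Prop)
    (h0 : ¬P → hwvSpace Λ d = ⊥) (hP : P → hwvSpace Λ d ≤ orbitVanishing t) : hwvSpace Λ d ≤ orbitVanishing t := by
  by_cases hp : P
  · exact hP hp
  · rw [h0 hp]
    exact bot_le

/-- Case split used off the window (multiplicity side). [bookkeeping] -/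
theorem coMult_le_of_cases {m : ℕ} {Λ : Fin 3 → Fin m → ℕ} {d : ℕ} {t : Tensor ℂ m} (P : Prop)
    (h0 : ¬P → coMult (unitTensor ℂ m) Λ d = 0) (hP : P → coMult (unitTensor ℂ m) Λ d ≤ coMult t Λ d) :
    coMult (unitTensor ℂ m) Λ d ≤ coMult t Λ d := by
  by_cases hp : P
  · exact hP hp
  · rw [h0 hp]
    exact Nat.zero_le _

/-- For `τ ≥ 4` and `n^τ ≤ m`: `n²·n² ≤ m`. [bookkeeping] -/
theorem sq_mul_sq_le_of_four_le {τ : ℝ} (hτ : 4 ≤ τ) {n m : ℕ} (hτm : (n : ℝ) ^ τ ≤ (m : ℝ)) :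
    n * n * (n * n) ≤ m := by
  rcases Nat.eq_zero_or_pos n with h0 | hn
  · subst h0
    simp
  · have h1 : (1 : ℝ) ≤ n := by exact_mod_cast hn
    have h4 : (n : ℝ) ^ (4 : ℝ) = ((n * n * (n * n) : ℕ) : ℝ) := by
      rw [show (4 : ℝ) = ((4 : ℕ) : ℝ) by norm_num, Real.rpow_natCast]
      push_cast
      ring
    have : ((n * n * (n * n) : ℕ) : ℝ) ≤ (m : ℝ) := (h4 ▸ Real.rpow_le_rpow_of_exponent_le h1 hτ).trans hτm
    exact_mod_cast this

/-! ### §1 · The crux line of `P_O` by name: `UnitSaturationCore ⟹ UnitSaturation ⟹ P_O` -/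

/-- RUNG (kernel): the UnitSaturation clause for `τ ≥ 4` — at scale `m ≥ n^τ ≥ n⁴` two few-part slots bound the rank of everything
a weight vector of the type can see (engine 1). [this node] -/
theorem unitSaturation_of_four_le {τ : ℝ} (hτ : 4 ≤ τ) {n m : ℕ} (hτm : (n : ℝ) ^ τ ≤ (m : ℝ))
    (Λ : Fin 3 → Fin m → ℕ) (d : ℕ) (h₀ : (Finset.univ.filter fun a => Λ 0 a ≠ 0).card ≤ n * n)
    (h₁ : (Finset.univ.filter fun a => Λ 1 a ≠ 0).card ≤ n * n)
    (hU : hwvSpace Λ d ≤ orbitVanishing (unitTensor ℂ m)) : hwvSpace Λ d = ⊥ :=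
  hwvSpace_eq_bot_of_card_mul_card_le ((Nat.mul_le_mul h₀ h₁).trans (sq_mul_sq_le_of_four_le hτ hτm)) hU

/-- RE-CUT COMPOSITION (kernel): `UnitSaturationCore ⟹ UnitSaturation` — off the core window the saturation clause is a theorem
(`τ ≥ 4`: `unitSaturation_of_four_le`; `d ≤ m`: engine 2; a slot pair with `≤ m` part-pairs: engine 1). [this node] -/
theorem unitSaturation_of_core
    (hcore : ∀ τ : ℝ, 2 < τ → τ < 4 → ∃ n₀ : ℕ, ∀ n m : ℕ, n₀ ≤ n → n * n ≤ m → (n : ℝ) ^ τ ≤ (m : ℝ) →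
      ∀ (Λ : Fin 3 → Fin m → ℕ) (d : ℕ), m < d → (∀ s, (Finset.univ.filter fun a => Λ s a ≠ 0).card ≤ n * n) →
        m < (Finset.univ.filter fun a => Λ 0 a ≠ 0).card * (Finset.univ.filter fun a => Λ 1 a ≠ 0).card →
        m < (Finset.univ.filter fun a => Λ 0 a ≠ 0).card * (Finset.univ.filter fun a => Λ 2 a ≠ 0).card →
        m < (Finset.univ.filter fun a => Λ 1 a ≠ 0).card * (Finset.univ.filter fun a => Λ 2 a ≠ 0).card →
          hwvSpace Λ d ≤ orbitVanishing (unitTensor ℂ m) → hwvSpace Λ d = ⊥) :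
    ∀ τ : ℝ, 2 < τ → ∃ n₀ : ℕ, ∀ n m : ℕ, n₀ ≤ n → n * n ≤ m → (n : ℝ) ^ τ ≤ (m : ℝ) →
      ∀ (Λ : Fin 3 → Fin m → ℕ) (d : ℕ), (∀ s, (Finset.univ.filter fun a => Λ s a ≠ 0).card ≤ n * n) →
        hwvSpace Λ d ≤ orbitVanishing (unitTensor ℂ m) → hwvSpace Λ d = ⊥ := by
  intro τ hτ
  by_cases h4 : 4 ≤ τ
  · exact ⟨0, fun n m _ _ hτm Λ d hp hU => unitSaturation_of_four_le h4 hτm Λ d (hp 0) (hp 1) hU⟩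
  · obtain ⟨n₀, hn₀⟩ := hcore τ hτ (lt_of_not_ge h4)
    refine ⟨n₀, fun n m hn hnm hτm Λ d hparts hU => ?_⟩
    by_cases hd : d ≤ m
    · exact hwvSpace_eq_bot_of_degree_le hd hU
    by_cases h01 : (Finset.univ.filter fun a => Λ 0 a ≠ 0).card * (Finset.univ.filter fun a => Λ 1 a ≠ 0).card ≤ m
    · exact hwvSpace_eq_bot_of_card_mul_card_le h01 hU
    by_cases h02 : (Finset.univ.filter fun a => Λ 0 a ≠ 0).card * (Finset.univ.filter fun a => Λ 2 a ≠ 0).card ≤ m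
    · exact hwvSpace_eq_bot_of_card_mul_card_le₀₂ h02 hU
    by_cases h12 : (Finset.univ.filter fun a => Λ 1 a ≠ 0).card * (Finset.univ.filter fun a => Λ 2 a ≠ 0).card ≤ m
    · exact hwvSpace_eq_bot_of_card_mul_card_le₁₂ h12 hU
    exact hn₀ n m hn hnm hτm Λ d (lt_of_not_ge hd) hparts (lt_of_not_ge h01) (lt_of_not_ge h02)
      (lt_of_not_ge h12) hU

/-- COMPOSITION (kernel): `UnitSaturation ⟹ P_O` — a type with at most `n²` parts in every slot all of whose weight vectors vanish
on `σ_m` has none, and a type with more parts in some slot vanishes on the padded tensor's orbit outright (PadInheritance, the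
landed `hwvSpace_le_orbitVanishing_padMM_of_lt_card`). [this node] -/
theorem noOccurrenceObstruction_of_unitSaturation
    (h₁ : ∀ τ : ℝ, 2 < τ → ∃ n₀ : ℕ, ∀ n m : ℕ, n₀ ≤ n → n * n ≤ m → (n : ℝ) ^ τ ≤ (m : ℝ) →
      ∀ (Λ : Fin 3 → Fin m → ℕ) (d : ℕ), (∀ s, (Finset.univ.filter fun a => Λ s a ≠ 0).card ≤ n * n) →
        hwvSpace Λ d ≤ orbitVanishing (unitTensor ℂ m) → hwvSpace Λ d = ⊥) :
    NoOccurrenceObstruction := by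
  rw [noOccurrenceObstruction_iff]
  intro τ hτ
  obtain ⟨n₀, hn₀⟩ := h₁ τ hτ
  refine ⟨n₀, fun n m hn h hτm Λ d hU => ?_⟩
  by_cases hfew : ∀ s, (Finset.univ.filter fun a => Λ s a ≠ 0).card ≤ n * n
  · rw [hn₀ n m hn h hτm Λ d hfew hU]
    exact bot_le
  · simp only [not_forall, not_le] at hfew
    obtain ⟨s, hs⟩ := hfew
    exact hwvSpace_le_orbitVanishing_padMM_of_lt_card h Λ d hs

/-- **The line of crux 29040 by name**: `UnitSaturationCore ⟹ NoOccurrenceObstruction` (the registered skeleton's composition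
`stub_unitSaturationCore → P_O`, with its `parts` inlined; no `sorry` of its own). [this node] -/
theorem noOccurrenceObstruction_of_core
    (hcore : ∀ τ : ℝ, 2 < τ → τ < 4 → ∃ n₀ : ℕ, ∀ n m : ℕ, n₀ ≤ n → n * n ≤ m → (n : ℝ) ^ τ ≤ (m : ℝ) →
      ∀ (Λ : Fin 3 → Fin m → ℕ) (d : ℕ), m < d → (∀ s, (Finset.univ.filter fun a => Λ s a ≠ 0).card ≤ n * n) →
        m < (Finset.univ.filter fun a => Λ 0 a ≠ 0).card * (Finset.univ.filter fun a => Λ 1 a ≠ 0).card →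
        m < (Finset.univ.filter fun a => Λ 0 a ≠ 0).card * (Finset.univ.filter fun a => Λ 2 a ≠ 0).card →
        m < (Finset.univ.filter fun a => Λ 1 a ≠ 0).card * (Finset.univ.filter fun a => Λ 2 a ≠ 0).card →
          hwvSpace Λ d ≤ orbitVanishing (unitTensor ℂ m) → hwvSpace Λ d = ⊥) :
    NoOccurrenceObstruction :=
  noOccurrenceObstruction_of_unitSaturation (unitSaturation_of_core hcore)

/-! ### §2 · Localisation of `P_O` -/

/-- **`P_O` lives on the core window**: `NoOccurrenceObstruction` is EQUIVALENT to its restriction to `τ < 4`, `d > m`, at most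
`n²` parts per slot and more than `m` part-pairs per slot pair — off the window each instance is a theorem (pad inheritance /
saturation engines 1–2 / the `τ ≥ 4` rung). [this node] -/
theorem noOccurrenceObstruction_iff_core : NoOccurrenceObstruction ↔
    ∀ τ : ℝ, 2 < τ → τ < 4 → ∃ n₀ : ℕ, ∀ n m : ℕ, n₀ ≤ n → ∀ h : n * n ≤ m, (n : ℝ) ^ τ ≤ (m : ℝ) →
      ∀ (Λ : Fin 3 → Fin m → ℕ) (d : ℕ), m < d → (∀ s, (Finset.univ.filter fun a => Λ s a ≠ 0).card ≤ n * n) →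
        m < (Finset.univ.filter fun a => Λ 0 a ≠ 0).card * (Finset.univ.filter fun a => Λ 1 a ≠ 0).card →
        m < (Finset.univ.filter fun a => Λ 0 a ≠ 0).card * (Finset.univ.filter fun a => Λ 2 a ≠ 0).card →
        m < (Finset.univ.filter fun a => Λ 1 a ≠ 0).card * (Finset.univ.filter fun a => Λ 2 a ≠ 0).card →
          hwvSpace Λ d ≤ orbitVanishing (unitTensor ℂ m) → hwvSpace Λ d ≤ orbitVanishing (padMM ℂ n m h) := by
  rw [noOccurrenceObstruction_iff]
  refine ⟨fun H τ hτ _ => ?_, fun H τ hτ => ?_⟩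
  · obtain ⟨n₀, hn₀⟩ := H τ hτ
    exact ⟨n₀, fun n m hn h hτm Λ d _ _ _ _ _ hU => hn₀ n m hn h hτm Λ d hU⟩
  · -- off the window: pad inheritance or saturation
    have off : ∀ n m : ℕ, ∀ h : n * n ≤ m, ∀ (Λ : Fin 3 → Fin m → ℕ) (d : ℕ),
        hwvSpace Λ d ≤ orbitVanishing (unitTensor ℂ m) →
        ((∀ s, (Finset.univ.filter fun a => Λ s a ≠ 0).card ≤ n * n) → m < d →
          m < (Finset.univ.filter fun a => Λ 0 a ≠ 0).card * (Finset.univ.filter fun a => Λ 1 a ≠ 0).card →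
          m < (Finset.univ.filter fun a => Λ 0 a ≠ 0).card * (Finset.univ.filter fun a => Λ 2 a ≠ 0).card →
          m < (Finset.univ.filter fun a => Λ 1 a ≠ 0).card * (Finset.univ.filter fun a => Λ 2 a ≠ 0).card →
          hwvSpace Λ d ≤ orbitVanishing (padMM ℂ n m h)) →
        hwvSpace Λ d ≤ orbitVanishing (padMM ℂ n m h) := by
      intro n m h Λ d hU hwin
      by_cases hfew : ∀ s, (Finset.univ.filter fun a => Λ s a ≠ 0).card ≤ n * n
      swap
      · simp only [not_forall, not_le] at hfew
        obtain ⟨s, hs⟩ := hfew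
        exact hwvSpace_le_orbitVanishing_padMM_of_lt_card h Λ d hs
      refine hwvSpace_le_of_cases (m < d) (fun hd => hwvSpace_eq_bot_of_degree_le (le_of_not_gt hd) hU) fun hd => ?_
      refine hwvSpace_le_of_cases
        (m < (Finset.univ.filter fun a => Λ 0 a ≠ 0).card * (Finset.univ.filter fun a => Λ 1 a ≠ 0).card)
        (fun h01 => hwvSpace_eq_bot_of_card_mul_card_le (le_of_not_gt h01) hU) fun h01 => ?_
      refine hwvSpace_le_of_cases
        (m < (Finset.univ.filter fun a => Λ 0 a ≠ 0).card * (Finset.univ.filter fun a => Λ 2 a ≠ 0).card)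
        (fun h02 => hwvSpace_eq_bot_of_card_mul_card_le₀₂ (le_of_not_gt h02) hU) fun h02 => ?_
      refine hwvSpace_le_of_cases
        (m < (Finset.univ.filter fun a => Λ 1 a ≠ 0).card * (Finset.univ.filter fun a => Λ 2 a ≠ 0).card)
        (fun h12 => hwvSpace_eq_bot_of_card_mul_card_le₁₂ (le_of_not_gt h12) hU) fun h12 => ?_
      exact hwin hfew hd h01 h02 h12
    by_cases h4 : 4 ≤ τ
    · refine ⟨0, fun n m _ h hτm Λ d hU => off n m h Λ d hU fun hfew _ _ _ _ => ?_⟩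
      rw [unitSaturation_of_four_le h4 hτm Λ d (hfew 0) (hfew 1) hU]
      exact bot_le
    · obtain ⟨n₀, hn₀⟩ := H τ hτ (lt_of_not_ge h4)
      exact ⟨n₀, fun n m hn h hτm Λ d hU => off n m h Λ d hU fun hfew hd h01 h02 h12 =>
        hn₀ n m hn h hτm Λ d hd hfew h01 h02 h12 hU⟩

/-- The saturation form on the window (`UnitSaturationCore`) implies the window form of `P_O` (so the open stub is SUFFICIENT for
the crux, and `P_O|core` is its necessary-and-sufficient residue). [this node] -/
theorem coreO_of_coreSat
    (hcore : ∀ τ : ℝ, 2 < τ → τ < 4 → ∃ n₀ : ℕ, ∀ n m : ℕ, n₀ ≤ n → n * n ≤ m → (n : ℝ) ^ τ ≤ (m : ℝ) →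
      ∀ (Λ : Fin 3 → Fin m → ℕ) (d : ℕ), m < d → (∀ s, (Finset.univ.filter fun a => Λ s a ≠ 0).card ≤ n * n) →
        m < (Finset.univ.filter fun a => Λ 0 a ≠ 0).card * (Finset.univ.filter fun a => Λ 1 a ≠ 0).card →
        m < (Finset.univ.filter fun a => Λ 0 a ≠ 0).card * (Finset.univ.filter fun a => Λ 2 a ≠ 0).card →
        m < (Finset.univ.filter fun a => Λ 1 a ≠ 0).card * (Finset.univ.filter fun a => Λ 2 a ≠ 0).card →
          hwvSpace Λ d ≤ orbitVanishing (unitTensor ℂ m) → hwvSpace Λ d = ⊥) :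
    ∀ τ : ℝ, 2 < τ → τ < 4 → ∃ n₀ : ℕ, ∀ n m : ℕ, n₀ ≤ n → ∀ h : n * n ≤ m, (n : ℝ) ^ τ ≤ (m : ℝ) →
      ∀ (Λ : Fin 3 → Fin m → ℕ) (d : ℕ), m < d → (∀ s, (Finset.univ.filter fun a => Λ s a ≠ 0).card ≤ n * n) →
        m < (Finset.univ.filter fun a => Λ 0 a ≠ 0).card * (Finset.univ.filter fun a => Λ 1 a ≠ 0).card →
        m < (Finset.univ.filter fun a => Λ 0 a ≠ 0).card * (Finset.univ.filter fun a => Λ 2 a ≠ 0).card →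
        m < (Finset.univ.filter fun a => Λ 1 a ≠ 0).card * (Finset.univ.filter fun a => Λ 2 a ≠ 0).card →
          hwvSpace Λ d ≤ orbitVanishing (unitTensor ℂ m) → hwvSpace Λ d ≤ orbitVanishing (padMM ℂ n m h) := by
  intro τ hτ hτ4
  obtain ⟨n₀, hn₀⟩ := hcore τ hτ hτ4
  refine ⟨n₀, fun n m hn h hτm Λ d hd hfew h01 h02 h12 hU => ?_⟩
  rw [hn₀ n m hn h hτm Λ d hd hfew h01 h02 h12 hU]
  exact bot_le

/-- NEC of the window form: `ω(ℂ) = 2 ⟹ P_O|core`. [this node] -/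
theorem coreO_of_summit (hS : _root_.MatrixMultiplication) :
    ∀ τ : ℝ, 2 < τ → τ < 4 → ∃ n₀ : ℕ, ∀ n m : ℕ, n₀ ≤ n → ∀ h : n * n ≤ m, (n : ℝ) ^ τ ≤ (m : ℝ) →
      ∀ (Λ : Fin 3 → Fin m → ℕ) (d : ℕ), m < d → (∀ s, (Finset.univ.filter fun a => Λ s a ≠ 0).card ≤ n * n) →
        m < (Finset.univ.filter fun a => Λ 0 a ≠ 0).card * (Finset.univ.filter fun a => Λ 1 a ≠ 0).card →
        m < (Finset.univ.filter fun a => Λ 0 a ≠ 0).card * (Finset.univ.filter fun a => Λ 2 a ≠ 0).card →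
        m < (Finset.univ.filter fun a => Λ 1 a ≠ 0).card * (Finset.univ.filter fun a => Λ 2 a ≠ 0).card →
          hwvSpace Λ d ≤ orbitVanishing (unitTensor ℂ m) → hwvSpace Λ d ≤ orbitVanishing (padMM ℂ n m h) :=
  noOccurrenceObstruction_iff_core.1 (noOccurrenceObstruction_of_summit hS)

/-! ### §3 · Localisation of `P_M` and of `L` -/

/-- **`P_M` lives on the core window**: `NoMultiplicityObstruction` is EQUIVALENT to its restriction to the same window — off it,
many parts give `coMult u ≤ coMult pad` for every `u` (`coMult_le_coMult_padMM_of_lt_card`) and the pointwise engines give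
`coMult ⟨m⟩ Λ d = 0` (`coMult_unitTensor_eq_zero_of_…`). [this node] -/
theorem noMultiplicityObstruction_iff_core : NoMultiplicityObstruction ↔
    ∀ τ : ℝ, 2 < τ → τ < 4 → ∃ n₀ : ℕ, ∀ n m : ℕ, n₀ ≤ n → ∀ h : n * n ≤ m, (n : ℝ) ^ τ ≤ (m : ℝ) →
      ∀ (Λ : Fin 3 → Fin m → ℕ) (d : ℕ), m < d → (∀ s, (Finset.univ.filter fun a => Λ s a ≠ 0).card ≤ n * n) →
        m < (Finset.univ.filter fun a => Λ 0 a ≠ 0).card * (Finset.univ.filter fun a => Λ 1 a ≠ 0).card →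
        m < (Finset.univ.filter fun a => Λ 0 a ≠ 0).card * (Finset.univ.filter fun a => Λ 2 a ≠ 0).card →
        m < (Finset.univ.filter fun a => Λ 1 a ≠ 0).card * (Finset.univ.filter fun a => Λ 2 a ≠ 0).card →
          coMult (unitTensor ℂ m) Λ d ≤ coMult (padMM ℂ n m h) Λ d := by
  rw [noMultiplicityObstruction_iff]
  refine ⟨fun H τ hτ _ => ?_, fun H τ hτ => ?_⟩
  · obtain ⟨n₀, hn₀⟩ := H τ hτ
    exact ⟨n₀, fun n m hn h hτm Λ d _ _ _ _ _ => hn₀ n m hn h hτm Λ d⟩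
  · have off : ∀ n m : ℕ, ∀ h : n * n ≤ m, ∀ (Λ : Fin 3 → Fin m → ℕ) (d : ℕ),
        ((∀ s, (Finset.univ.filter fun a => Λ s a ≠ 0).card ≤ n * n) → m < d →
          m < (Finset.univ.filter fun a => Λ 0 a ≠ 0).card * (Finset.univ.filter fun a => Λ 1 a ≠ 0).card →
          m < (Finset.univ.filter fun a => Λ 0 a ≠ 0).card * (Finset.univ.filter fun a => Λ 2 a ≠ 0).card →
          m < (Finset.univ.filter fun a => Λ 1 a ≠ 0).card * (Finset.univ.filter fun a => Λ 2 a ≠ 0).card →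
          coMult (unitTensor ℂ m) Λ d ≤ coMult (padMM ℂ n m h) Λ d) →
        coMult (unitTensor ℂ m) Λ d ≤ coMult (padMM ℂ n m h) Λ d := by
      intro n m h Λ d hwin
      by_cases hfew : ∀ s, (Finset.univ.filter fun a => Λ s a ≠ 0).card ≤ n * n
      swap
      · simp only [not_forall, not_le] at hfew
        obtain ⟨s, hs⟩ := hfew
        exact coMult_le_coMult_padMM_of_lt_card h Λ d hs _
      refine coMult_le_of_cases (m < d) (fun hd => coMult_unitTensor_eq_zero_of_degree_le Λ (le_of_not_gt hd))
        fun hd => ?_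
      refine coMult_le_of_cases
        (m < (Finset.univ.filter fun a => Λ 0 a ≠ 0).card * (Finset.univ.filter fun a => Λ 1 a ≠ 0).card)
        (fun h01 => coMult_unitTensor_eq_zero_of_card_mul_card_le (le_of_not_gt h01)) fun h01 => ?_
      refine coMult_le_of_cases
        (m < (Finset.univ.filter fun a => Λ 0 a ≠ 0).card * (Finset.univ.filter fun a => Λ 2 a ≠ 0).card)
        (fun h02 => coMult_unitTensor_eq_zero_of_card_mul_card_le₀₂ (le_of_not_gt h02)) fun h02 => ?_
      refine coMult_le_of_cases
        (m < (Finset.univ.filter fun a => Λ 1 a ≠ 0).card * (Finset.univ.filter fun a => Λ 2 a ≠ 0).card)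
        (fun h12 => coMult_unitTensor_eq_zero_of_card_mul_card_le₁₂ (le_of_not_gt h12)) fun h12 => ?_
      exact hwin hfew hd h01 h02 h12
    by_cases h4 : 4 ≤ τ
    · refine ⟨0, fun n m _ h hτm Λ d => off n m h Λ d fun hfew _ _ _ _ => ?_⟩
      rw [coMult_unitTensor_eq_zero_of_card_mul_card_le
        ((Nat.mul_le_mul (hfew 0) (hfew 1)).trans (sq_mul_sq_le_of_four_le h4 hτm))]
      exact Nat.zero_le _
    · obtain ⟨n₀, hn₀⟩ := H τ hτ (lt_of_not_ge h4)
      exact ⟨n₀, fun n m hn h hτm Λ d => off n m h Λ d fun hfew hd h01 h02 h12 =>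
        hn₀ n m hn h hτm Λ d hd hfew h01 h02 h12⟩

/-- NEC of the window form: `ω(ℂ) = 2 ⟹ P_M|core`. [this node] -/
theorem coreM_of_summit (hS : _root_.MatrixMultiplication) :
    ∀ τ : ℝ, 2 < τ → τ < 4 → ∃ n₀ : ℕ, ∀ n m : ℕ, n₀ ≤ n → ∀ h : n * n ≤ m, (n : ℝ) ^ τ ≤ (m : ℝ) →
      ∀ (Λ : Fin 3 → Fin m → ℕ) (d : ℕ), m < d → (∀ s, (Finset.univ.filter fun a => Λ s a ≠ 0).card ≤ n * n) →
        m < (Finset.univ.filter fun a => Λ 0 a ≠ 0).card * (Finset.univ.filter fun a => Λ 1 a ≠ 0).card →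
        m < (Finset.univ.filter fun a => Λ 0 a ≠ 0).card * (Finset.univ.filter fun a => Λ 2 a ≠ 0).card →
        m < (Finset.univ.filter fun a => Λ 1 a ≠ 0).card * (Finset.univ.filter fun a => Λ 2 a ≠ 0).card →
          coMult (unitTensor ℂ m) Λ d ≤ coMult (padMM ℂ n m h) Λ d :=
  noMultiplicityObstruction_iff_core.1 (noMultiplicityObstruction_of_summit hS)

/-- **`L` lives on the core window**: `OccurrenceLifts ⟺ (P_O → P_M|core)`. [this node] -/
theorem occurrenceLifts_iff_core : OccurrenceLifts ↔ (NoOccurrenceObstruction →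
    ∀ τ : ℝ, 2 < τ → τ < 4 → ∃ n₀ : ℕ, ∀ n m : ℕ, n₀ ≤ n → ∀ h : n * n ≤ m, (n : ℝ) ^ τ ≤ (m : ℝ) →
      ∀ (Λ : Fin 3 → Fin m → ℕ) (d : ℕ), m < d → (∀ s, (Finset.univ.filter fun a => Λ s a ≠ 0).card ≤ n * n) →
        m < (Finset.univ.filter fun a => Λ 0 a ≠ 0).card * (Finset.univ.filter fun a => Λ 1 a ≠ 0).card →
        m < (Finset.univ.filter fun a => Λ 0 a ≠ 0).card * (Finset.univ.filter fun a => Λ 2 a ≠ 0).card →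
        m < (Finset.univ.filter fun a => Λ 1 a ≠ 0).card * (Finset.univ.filter fun a => Λ 2 a ≠ 0).card →
          coMult (unitTensor ℂ m) Λ d ≤ coMult (padMM ℂ n m h) Λ d) := by
  unfold OccurrenceLifts
  rw [noMultiplicityObstruction_iff_core]

/-- A CELL-WISE sufficient condition for `L`: if, on the core window and eventually in `n`, occurrence inclusion implies
multiplicity domination cell by cell, then `OccurrenceLifts` (the hypothesis `P_O` supplies the inclusion at every cell).
[this node] -/
theorem occurrenceLifts_of_cellwise
    (hcell : ∀ τ : ℝ, 2 < τ → τ < 4 → ∃ n₀ : ℕ, ∀ n m : ℕ, n₀ ≤ n → ∀ h : n * n ≤ m, (n : ℝ) ^ τ ≤ (m : ℝ) →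
      ∀ (Λ : Fin 3 → Fin m → ℕ) (d : ℕ), m < d → (∀ s, (Finset.univ.filter fun a => Λ s a ≠ 0).card ≤ n * n) →
        m < (Finset.univ.filter fun a => Λ 0 a ≠ 0).card * (Finset.univ.filter fun a => Λ 1 a ≠ 0).card →
        m < (Finset.univ.filter fun a => Λ 0 a ≠ 0).card * (Finset.univ.filter fun a => Λ 2 a ≠ 0).card →
        m < (Finset.univ.filter fun a => Λ 1 a ≠ 0).card * (Finset.univ.filter fun a => Λ 2 a ≠ 0).card →
          (hwvSpace Λ d ≤ orbitVanishing (unitTensor ℂ m) → hwvSpace Λ d ≤ orbitVanishing (padMM ℂ n m h)) →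
          coMult (unitTensor ℂ m) Λ d ≤ coMult (padMM ℂ n m h) Λ d) :
    OccurrenceLifts := by
  refine occurrenceLifts_iff_core.2 fun hO τ hτ hτ4 => ?_
  obtain ⟨n₁, hn₁⟩ := noOccurrenceObstruction_iff.1 hO τ hτ
  obtain ⟨n₂, hn₂⟩ := hcell τ hτ hτ4
  refine ⟨max n₁ n₂, fun n m hn h hτm Λ d hd hfew h01 h02 h12 => ?_⟩
  exact hn₂ n m (le_trans (le_max_right _ _) hn) h hτm Λ d hd hfew h01 h02 h12
    (hn₁ n m (le_trans (le_max_left _ _) hn) h hτm Λ d)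

end Summit.MatrixMultiplication.MatrixMultiplication.Theorems.ObstructionDescentCoreWindow

end
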